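import Summits.KontsevichZagierPeriods.KontsevichZagierPeriods.Theses.AyoubSpecialisation
import Summits.KontsevichZagierPeriods.KontsevichZagierPeriods.Theses.LiftingCriteria
import Summits.KontsevichZagierPeriods.KontsevichZagierPeriods.Theorems.FurushoPentagonSectorToKernelResolvedRing
import Summits.KontsevichZagierPeriods.KontsevichZagierPeriods.Theorems.HurwitzMicroSectorsNormalFormPrinciplePiBoxTower
import Summits.KontsevichZagierPeriods.KontsevichZagierPeriods.Theorems.HurwitzMicroSectorsNormalFormPrincipleStubPiCalibration
import Summits.KontsevichZagierPeriods.KontsevichZagierPeriods.Theorems.TerasomaMultiplicationBetaCancellationOfAyoubPiCancellation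
import Summits.KontsevichZagierPeriods.KontsevichZagierPeriods.Theorems.MzvKernelInKZ.Negative.ScalingDivision
import Literature.NumberTheory.Transcendental.KZCubicalCalculus
import Literature.NumberTheory.Transcendental.KZProduct
import Literature.NumberTheory.Transcendental.KZProductIdeal

/-!
# Birth skeleton for child 2 of the `[π]`-split of `MultiCoVKernel` (stmt-2873):
# `AyoubPiCancellation` (item stmt-KontsevichZagierPeriods-0540), line `picut-cancellation`

Crux-strategist (unit `cstrat-stmt-KontsevichZagierPeriods-2873-r1`). The item is shared by routes
AyoubSpecialisation / KatzTower / SpheresForWalls / HurwitzMicroSectors / LiouvilleUnfolding /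
AttractorUnfolding / MultivaluedCoV (rev 2) with byte-identical bodies (⇔ `KZ.PiCancellation`, landed
`BetaCancellationLine.stub_ayoubBridge`; ⇔ TerasomaMultiplication's `BetaCancellation`); this skeleton
concludes it under its oldest name `AyoubSpecialisation.AyoubPiCancellation`.

LINE (the only structural road on record, typed): `π`-cancellation ⟸
  (S1) cube-Nash normal form [theorem-type, item 3574] ∧
  (S2) KERNEL CONTROL modulo `κ`-powers — the comparison KZ ⇒ Ayoub: a `ℤ`-combination of tame cube classes
       that is a KZ relation lies, after finitely many `[κ]`-multiplications, in Ayoub's module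
       `ayoubIdeal = ⟨linearity ∪ Stokes⟩` [theorem-type XL, summit-free: a sound Nori/Kontsevich symbol on
       the four moves + Ayoub 2014 Prop. 11] ∧
  (S3) EFFECTIVE INJECTIVITY for Ayoub's presentation: `[κ]` is a non-zero-divisor on cube classes modulo
       `ayoubIdeal` [the printed OPEN question, Huber–Wüstholz 2022 App. A.4 / Ayoub 2015 Rem. 1.3,
       transcribed; transcendence-free],
with the 2-TORSION step (`[π] ≡ 2[κ]` introduces a factor 2) discharged by the LANDED torsion-freeness of
`FormalRep ⧸ relations` (`MzvKernelInKZ.Negative.mem_relations_of_nsmul_mem`, scaling division).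
Composition: `[π]⋆c ∈ rel` ⇒ (resolve `c ≡ a`, ideal) `[π]⋆a ∈ rel` ⇒ (calibration) `[κ]⋆(2a) ∈ rel` ⇒ (S2)
`[κ]^(N+1) (2a) ∈ ayoubIdeal` ⇒ (S3, iterated) `2a ∈ ayoubIdeal ⊆ rel` ⇒ (torsion) `a ∈ rel` ⇒ `c ∈ rel`.

Registered stubs (3): `stub_cubeNashNormalForm`, `stub_kernelControlModKappa`, `stub_ayoubEffectiveInjective`.
Proved (no `sorry` outside the stubs): `ayoubIdeal_le_relations`, `kappa_mem_cubicalGens`,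
`piCancellation_of : KZ.PiCancellation`, `AyoubPiCancellation_of` (the item by name, via `stub_ayoubBridge`).
Honesty: S2 ∧ S3 are jointly close to "KZ-cube classes embed in Ayoub's localised ring AND the latter is
effective-regular"; S3 is where the open problem sits (its KZ-side twin is the item itself), S2 is the
formalisation programme shared with the ReducedPeriodRing / NormalFormPrinciple lines.
-/

noncomputable section

set_option linter.dupNamespace false

namespace Summit.KontsevichZagierPeriods.KontsevichZagierPeriods.Cruxes.MultiCoVKernel.PiCutCancellation

open Set MeasureTheory
open Literature.NumberTheory.Transcendental
open Literature.NumberTheory.Transcendental.KZ hiding cubicalSpan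
open Summit.KontsevichZagierPeriods.FurushoPentagon.ReducedPeriodRing (unitCube cubicalGens cubicalSpan)
open Summit.KontsevichZagierPeriods.FurushoPentagon.SectorToKernel
  (cubeResolution_of_cubeNashNormalForm leaves_cubeNormalForm resolvedRing_mul_mem_cubicalSpan)
open Summit.KontsevichZagierPeriods.HurwitzMicroSectors.NormalFormPrinciple.PiBox
  (exists_kappa stub_piCalibration)

/-! ## Ayoub's presentation (real form) and the localising kernel `κ` -/

/-- Ayoub's relation module (real form): ℚ-linearity + Stokes on cubes. [cite: Ayoub2014, Def. 10] -/
def ayoubIdeal : AddSubgroup FormalRep :=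
  AddSubgroup.closure (KZ.cubicalLinGens ∪ KZ.cubicalStokesGens)

/-- `ayoubIdeal ≤ KZ.relations`. [cite: Ayoub2014, Def. 10] -/
theorem ayoubIdeal_le_relations : ayoubIdeal ≤ relations := by
  refine (AddSubgroup.closure_le _).mpr ?_
  rintro x (hx | hx)
  · exact KZ.cubicalLinGens_subset_relations hx
  · exact KZ.cubicalStokesGens_subset_relations hx

/-- The localising element `κ = [[0,1], du/((1−u)²+u²)]`, pinned by domain and integrand. [cite: KontsevichZagier2001, §1.1] -/
def IsKappa (κ : IntegralRep 1) : Prop :=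
  κ.domain = {x | x 0 ∈ Set.Icc (0:ℝ) 1} ∧ κ.integrand = (fun x => 1 / ((1 - x 0) ^ 2 + x 0 ^ 2))

/-- `κ` exists (landed `exists_kappa`). [folklore] -/
theorem exists_isKappa : ∃ κ : IntegralRep 1, IsKappa κ := exists_kappa

/-- `{x | x 0 ∈ [0,1]} = [0,1]¹`. [folklore] -/
theorem setOf_Icc_eq_unitCube : {x : Fin 1 → ℝ | x 0 ∈ Set.Icc (0:ℝ) 1} = unitCube 1 := by
  ext x
  simp only [mem_setOf_eq, Set.mem_Icc,
    Summit.KontsevichZagierPeriods.FurushoPentagon.ReducedPeriodRing.mem_unitCube, Fin.forall_fin_one]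

/-- The integrand of `κ` is real analytic everywhere (denominator `≥ 1/2`). [folklore] -/
theorem analyticOnNhd_kappaIntegrand (S : Set (Fin 1 → ℝ)) :
    AnalyticOnNhd ℝ (fun x : Fin 1 → ℝ => 1 / ((1 - x 0) ^ 2 + x 0 ^ 2)) S := by
  have h0 : AnalyticOnNhd ℝ (fun x : Fin 1 → ℝ => x 0) Set.univ :=
    (ContinuousLinearMap.proj (R := ℝ) (φ := fun _ : Fin 1 => ℝ) 0).analyticOnNhd _
  have hden : AnalyticOnNhd ℝ (fun x : Fin 1 → ℝ => (1 - x 0) ^ 2 + x 0 ^ 2) Set.univ :=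
    ((analyticOnNhd_const.sub h0).pow 2).add (h0.pow 2)
  have hpos : ∀ x : Fin 1 → ℝ, (1 - x 0) ^ 2 + x 0 ^ 2 ≠ 0 := fun x => by
    have : 0 < (1 - x 0) ^ 2 + x 0 ^ 2 := by nlinarith [sq_nonneg (x 0 - 1 / 2)]
    exact this.ne'
  exact (analyticOnNhd_const.div hden fun x _ => hpos x).mono (Set.subset_univ S)

/-- `[κ]` is a tame cube class. [folklore] -/
theorem kappa_mem_cubicalGens {κ : IntegralRep 1} (hκ : IsKappa κ) : of κ ∈ cubicalGens := by
  refine ⟨1, κ, ?_, ?_, rfl⟩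
  · rw [hκ.1, setOf_Icc_eq_unitCube]
  · rw [hκ.2]; exact analyticOnNhd_kappaIntegrand _

/-! ## Registered stubs (open) -/

/-- **S1 (cube-Nash normal form) = item stmt-KontsevichZagierPeriods-3574 (LiftingCriteria), by name.**
Theorem-grade. [cite: HuberMullerStachPeriods2017, §12.1; Ayoub2014, Rem. 12] -/
theorem stub_cubeNashNormalForm :
    Summit.KontsevichZagierPeriods.KontsevichZagierPeriods.Theses.LiftingCriteria.CubeNashNormalForm := by
  sorry

/-- **S2 (kernel control modulo `κ`-powers; the COMPARISON KZ ⇒ Ayoub; theorem-type XL, summit-free).**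
If a `ℤ`-combination `a` of tame cube classes is a KZ relation, then `[κ]^N ⋆ a` lies in Ayoub's module
for some `N`: a cube class killed by the four moves is killed by LINEARITY + STOKES alone once enough
factors `∫₀¹du/((1−u)²+u²)` are prefixed. Road: a sound additive symbol from `KZ.FormalRep` to the
formal period algebra of Nori/Kontsevich killing the four moves (HMS 2017 Ch. 12 in substance),
multiplicative on Fubini products, agreeing on cube classes with Ayoub's comparison map, which is
injective after inverting `2πi` (Ayoub 2014 Prop. 11); real descent. Verbatim the stub of the registered
ReducedPeriodRing line `ayoub_stokes_cartier` (shared formalisation programme). Why it might fail as typed: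
only if a semialgebraic (Nash, non-algebraic) change of variables is not a motivic relation, or real descent
loses 2-torsion. [cite: Ayoub2014, Prop. 11; HuberMullerStachPeriods2017, §12.1–13.1] -/
theorem stub_kernelControlModKappa :
    ∀ κ : IntegralRep 1, IsKappa κ → ∀ a : FormalRep, a ∈ cubicalSpan → a ∈ relations →
      ∃ N : ℕ, (fun x => of κ * x)^[N] a ∈ ayoubIdeal := by
  sorry

/-- **S3 (effective injectivity for Ayoub's presentation; hardest — the printed OPEN question,
transcendence-free).** `[κ]` is a non-zero-divisor on tame cube classes modulo Ayoub's module: if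
`[κ]^N ⋆ a ∈ ayoubIdeal` then `a ∈ ayoubIdeal`. Motivic shadow: injectivity of
`P̃(MM^eff_Nori) → P̃(MM_Nori)` / fullness of `MM^eff_Nori ⊂ MM_Nori` ("we do not know if it is full",
Huber–Wüstholz 2022 App. A.3; "it is also an open question whether … is injective", App. A.4); Ayoub's
relative theorem is proved only over `D(2πi⁻¹)` (Ayoub 2015 revisited, Rem. 1.3). Equivalent forms:
injectivity of the effective Ayoub ring into its localisation at `κ`. Neither implied by nor implying
the item abstractly (different presentations); it becomes the item exactly through S1 + S2 + torsion.
[cite: HuberWustholz2022, App. A.3–A.4; AyoubRelKZRevisited, Rem. 1.3] -/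
theorem stub_ayoubEffectiveInjective :
    ∀ κ : IntegralRep 1, IsKappa κ → ∀ a : FormalRep, a ∈ cubicalSpan → ∀ N : ℕ,
      (fun x => of κ * x)^[N] a ∈ ayoubIdeal → a ∈ ayoubIdeal := by
  sorry

/-! ## Proved: the composition -/

/-- **The composition, closed form**: S1 ∧ S2 ∧ S3 ⇒ `KZ.PiCancellation`
(`[π] ⋆ c ∈ relations → c ∈ relations`). [cite: HuberWustholz2022, App. A.4] -/
theorem piCancellation_of
    (hS1 : Summit.KontsevichZagierPeriods.KontsevichZagierPeriods.Theses.LiftingCriteria.CubeNashNormalForm)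
    (hS2 : ∀ κ : IntegralRep 1, IsKappa κ → ∀ a : FormalRep, a ∈ cubicalSpan → a ∈ relations →
      ∃ N : ℕ, (fun x => of κ * x)^[N] a ∈ ayoubIdeal)
    (hS3 : ∀ κ : IntegralRep 1, IsKappa κ → ∀ a : FormalRep, a ∈ cubicalSpan → ∀ N : ℕ,
      (fun x => of κ * x)^[N] a ∈ ayoubIdeal → a ∈ ayoubIdeal) :
    KZ.PiCancellation := by
  intro c hc
  obtain ⟨κ, hκ⟩ := exists_isKappa
  -- (S1) resolve `c ≡ a` into tame cube classes
  obtain ⟨a, ha, hca⟩ := leaves_cubeNormalForm (cubeResolution_of_cubeNashNormalForm hS1) c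
  -- `[π] ⋆ a ∈ relations` (left ideal)
  have hπa : of piRep * a ∈ relations := by
    have h1 : of piRep * c - of piRep * a ∈ relations := by
      rw [← mul_sub]; exact mul_mem_relations_left_holds _ _ hca
    have := relations.sub_mem hc h1
    simpa using this
  -- calibration `[π] ≡ 2[κ]` (right ideal): `[κ] ⋆ (2 • a) ∈ relations`
  have hπκ : of piRep - (2:ℕ) • of κ ∈ relations := stub_piCalibration κ hκ.1 hκ.2
  have hκ2a : of κ * ((2:ℕ) • a) ∈ relations := by
    have h2 : of piRep * a - ((2:ℕ) • of κ) * a ∈ relations := by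
      rw [← sub_mul]; exact mul_mem_relations_right_holds _ _ hπκ
    have h3 : ((2:ℕ) • of κ) * a = of κ * ((2:ℕ) • a) := by
      rw [smul_mul_assoc, mul_smul_comm]
    have := relations.sub_mem hπa h2
    rw [h3] at this
    simpa using this
  have h2a : (2:ℕ) • a ∈ cubicalSpan := cubicalSpan.nsmul_mem ha 2
  have hκ2a_span : of κ * ((2:ℕ) • a) ∈ cubicalSpan :=
    resolvedRing_mul_mem_cubicalSpan (AddSubgroup.subset_closure (kappa_mem_cubicalGens hκ)) h2a
  -- (S2) kernel control: `[κ]^N ⋆ ([κ] ⋆ 2a) ∈ ayoubIdeal`, i.e. `[κ]^(N+1) ⋆ 2a ∈ ayoubIdeal`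
  obtain ⟨N, hN⟩ := hS2 κ hκ _ hκ2a_span hκ2a
  have hN' : (fun x => of κ * x)^[N + 1] ((2:ℕ) • a) ∈ ayoubIdeal := by
    rw [Function.iterate_succ_apply]; exact hN
  -- (S3) effective injectivity: `2a ∈ ayoubIdeal ⊆ relations`
  have h2a_rel : (2:ℕ) • a ∈ relations := ayoubIdeal_le_relations (hS3 κ hκ _ h2a (N + 1) hN')
  -- torsion-freeness of `FormalRep ⧸ relations` (LANDED, scaling division): `a ∈ relations`
  have ha_rel : a ∈ relations :=
    Summit.KontsevichZagierPeriods.MzvKernelInKZ.Negative.mem_relations_of_nsmul_mem (by norm_num) h2a_rel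
  -- `c = (c − a) + a`
  have := relations.add_mem hca ha_rel
  simpa using this

/-- **The item by name** (pinned `∀ P` form, = stmt-KontsevichZagierPeriods-0540), from S1 ∧ S2 ∧ S3
through `piCancellation_of` and the landed bridge `BetaCancellationLine.stub_ayoubBridge`
(`AyoubPiCancellation ↔ KZ.PiCancellation`). [cite: HuberWustholz2022, App. A.4] -/
theorem AyoubPiCancellation_of :
    Summit.KontsevichZagierPeriods.KontsevichZagierPeriods.Theses.LiftingCriteria.CubeNashNormalForm →
    (∀ κ : IntegralRep 1, IsKappa κ → ∀ a : FormalRep, a ∈ cubicalSpan → a ∈ relations →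
      ∃ N : ℕ, (fun x => of κ * x)^[N] a ∈ ayoubIdeal) →
    (∀ κ : IntegralRep 1, IsKappa κ → ∀ a : FormalRep, a ∈ cubicalSpan → ∀ N : ℕ,
      (fun x => of κ * x)^[N] a ∈ ayoubIdeal → a ∈ ayoubIdeal) →
    Summit.KontsevichZagierPeriods.KontsevichZagierPeriods.Theses.AyoubSpecialisation.AyoubPiCancellation :=
  fun hS1 hS2 hS3 =>
    (Summit.KontsevichZagierPeriods.KontsevichZagierPeriods.BetaCancellationLine.stub_ayoubBridge).mpr
      (piCancellation_of hS1 hS2 hS3)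

/-- The item from the registered stubs. [folklore] -/
theorem AyoubPiCancellation_of_stubs :
    Summit.KontsevichZagierPeriods.KontsevichZagierPeriods.Theses.AyoubSpecialisation.AyoubPiCancellation :=
  AyoubPiCancellation_of stub_cubeNashNormalForm stub_kernelControlModKappa stub_ayoubEffectiveInjective

end Summit.KontsevichZagierPeriods.KontsevichZagierPeriods.Cruxes.MultiCoVKernel.PiCutCancellation

end
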